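import Summits.CriticalPhenomena.PercolationContinuityZ3.Theorems.PercNearOneGluingNoHeavyQuantLawDecStrongDuality
import Summits.CriticalPhenomena.PercolationContinuityZ3.Theorems.PercNearOneGluingNoHeavyQuantLawDecUsageMonge
import HarnessLib

/-!
# QUANT lane R8, T-DEC: THE MID-PRICE CRITERION — DEC at an explicit target from the dual with NORMALISED prices (giants priced `1/u`, lows
# priced at most `1`): `LawDec.decAtT_of_midPrices` (census-2 g59; the `k`-mid form of the knapsack criterion `decAtT_of_singleMid`)

builds on p205010 (kernel theorem, internal audit signed; external expert review pending)

Support file (`--supports stmt-CriticalPhenomena-4575`), QUANT lane seat prim-quant-census-2 (gen 59), rung R8 of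
`run/shared/lean/prim/quant/LADDER.md`.  Memo `run/shared/lean/prim/quant/prim-quant-census-2-g59/ASSEMBLY-G59.md` §4.  Theorems only,
standard axioms, no sorries, no definitions.

WHY.  Census-2 g54's strong duality `LawDec.decAtT_iff_prices` characterises `DECAtT x T j M μ` by ALL price systems (`α` on the lows, `β ≥ 0` on
the absorbers, `α l ≤ usage(l,h)·β h` on valid pairs).  Every giant has the same usage `u = x/(1−x)` and accepts every low, so the binding giant
price is `max_l α l / u` and the whole system may be normalised to `max_l α l ≤ 1`, giant price `1/u`.  What is left is a price `β h ≥ 0` on each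
MID only — for the pooled cells of the light-slice residue (one mid: `decAtT_of_singleMid`; two mids: the crossed Type II class with `p + h ≤ j`;
three mids: census-1 g22's MMG/LMG patterns) this is a piecewise-linear inequality in `k ≤ 3` nonnegative variables whose vertices are the
"breakpoint" cells:
* **`LawDec.decAtT_of_midPrices`** — floor `0 < x < 1`, law `μ ≥ 0` on `{0..M}` of mass one, `G = Σ_{j < k ≤ M} μ k`.  If for every `β ≥ 0` and
  every `α` with `α l ≤ 1` on the lows and `α l ≤ usage(l,h)·β h` for every low `l` and every compatible mid `h` (`h ≤ j`, `h ≤ M`, `¬ 2h < T`,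
  `T < l + h`) one
  has `Σ_{l low} α l·μ l ≤ Σ_{h mid} β h·μ h + G/u`, then `DECAtT x T j M μ`.
  (The cell prover eliminates `α` at once: `α l ≤ min(1, min_{h compatible} usage(l,h)·β h)`.)

[this work]; LP duality [cite: Schrijver1986, Cor 7.1f (p. 90)] via `…QuantLawDecStrongDuality`.  The gluing rows served
[cite: KozmaNitzan2024, Conjecture 3 (p. 15)]; product measure [cite: Grimmett1999, §1.3 p. 10].
-/

noncomputable section

namespace Summit.CriticalPhenomena.PercolationContinuityZ3.Theorems

namespace Quant

open Finset

namespace LawDec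

/-- **THE MID-PRICE CRITERION (normalised dual, sufficient form).**  See the module docstring. [this work] -/
theorem decAtT_of_midPrices (x T : ℝ) (j M : ℕ) (μ : ℕ → ℝ) (hx0 : 0 < x) (hx1 : x < 1)
    (hμ0 : ∀ k, 0 ≤ μ k) (hμM : ∀ k, M < k → μ k = 0) (hμ1 : ∑ k ∈ Finset.range (M + 1), μ k = 1)
    (hprice : ∀ α β : ℕ → ℝ, (∀ h, 0 ≤ β h) →
      (∀ l, l ≤ j → 2 * (l : ℝ) < T → α l ≤ 1) →
      (∀ l h, l ≤ j → 2 * (l : ℝ) < T → h ≤ j → h ≤ M → ¬ (2 * (h : ℝ) < T) → T < (l : ℝ) + h → α l ≤ usage x T j l h * β h) →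
      ∑ l ∈ Finset.range (j + 1), (if 2 * (l : ℝ) < T then α l * μ l else 0)
        ≤ ∑ h ∈ Finset.range (j + 1), (if 2 * (h : ℝ) < T then 0 else β h * μ h)
          + ((1 - x) / x) * ∑ k ∈ Finset.Ico (j + 1) (M + 1), μ k) :
    DECAtT x T j M μ := by
  classical
  rw [decAtT_iff_prices x T j M μ hx0 hx1 hμM hμ1]
  intro α β hβ hαβ
  have h1x : 0 < 1 - x := by linarith
  have hu0 : 0 < x / (1 - x) := div_pos hx0 h1x
  set G := ∑ k ∈ Finset.Ico (j + 1) (M + 1), μ k with hG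
  have hG0 : 0 ≤ G := Finset.sum_nonneg fun k _ => hμ0 k
  -- split the right-hand side into mids (`≤ j`, not low) and giants (`> j`)
  have hRHS : ∑ k ∈ Finset.range (M + 1), (if k ≤ j ∧ 2 * (k : ℝ) < T then 0 else β k * μ k)
      ≥ ∑ h ∈ Finset.range (j + 1), (if 2 * (h : ℝ) < T then 0 else β h * μ h) + ∑ k ∈ Finset.Ico (j + 1) (M + 1), β k * μ k := by
    -- the range `[0, M]` contains `[0, min(j,M)]` and `(j, M]`; terms are nonnegative
    have hsplit : ∑ k ∈ Finset.range (M + 1), (if k ≤ j ∧ 2 * (k : ℝ) < T then 0 else β k * μ k)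
        = ∑ k ∈ Finset.range (min j M + 1), (if k ≤ j ∧ 2 * (k : ℝ) < T then 0 else β k * μ k)
          + ∑ k ∈ Finset.Ico (j + 1) (M + 1), (if k ≤ j ∧ 2 * (k : ℝ) < T then 0 else β k * μ k) := by
      rw [Finset.range_eq_Ico, Finset.range_eq_Ico]
      by_cases hjM : j ≤ M
      · rw [min_eq_left hjM, ← Finset.sum_Ico_consecutive _ (by omega : 0 ≤ j + 1) (by omega : j + 1 ≤ M + 1)]
      · push Not at hjM
        rw [min_eq_right hjM.le, Finset.Ico_eq_empty (by omega : ¬ j + 1 < M + 1), Finset.sum_empty, add_zero]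
    rw [hsplit, ge_iff_le]
    refine add_le_add ?_ (le_of_eq ?_)
    · -- mids: the sum over `range (j+1)` restricted to `range (min j M + 1)` (terms beyond `M` vanish)
      have e : ∑ h ∈ Finset.range (j + 1), (if 2 * (h : ℝ) < T then 0 else β h * μ h)
          = ∑ h ∈ Finset.range (min j M + 1), (if 2 * (h : ℝ) < T then 0 else β h * μ h) := by
        by_cases hjM : j ≤ M
        · rw [min_eq_left hjM]
        · push Not at hjM
          rw [min_eq_right hjM.le]
          symm
          refine Finset.sum_subset (fun k hk => by rw [Finset.mem_range] at hk ⊢; omega) fun k hk hk' => ?_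
          rw [Finset.mem_range] at hk hk'
          have : μ k = 0 := hμM k (by omega)
          rw [this]; simp
      rw [e]
      refine Finset.sum_le_sum fun k hk => ?_
      rw [Finset.mem_range] at hk
      by_cases h2 : 2 * (k : ℝ) < T
      · rw [if_pos h2, if_pos ⟨by omega, h2⟩]
      · rw [if_neg h2, if_neg (by push Not; intro _; exact not_lt.1 h2)]
    · refine Finset.sum_congr rfl fun k hk => ?_
      rw [Finset.mem_Ico] at hk
      rw [if_neg (by push Not; intro h; exfalso; omega)]
  -- the lows and their maximal price
  set Lows := (Finset.range (j + 1)).filter (fun l : ℕ => 2 * ((l : ℕ) : ℝ) < T) with hLows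
  have hLHS : ∑ l ∈ Finset.range (j + 1), (if 2 * (l : ℝ) < T then α l * μ l else 0) = ∑ l ∈ Lows, α l * μ l := by
    rw [hLows, Finset.sum_filter]
  have hmids0 : 0 ≤ ∑ h ∈ Finset.range (j + 1), (if 2 * (h : ℝ) < T then 0 else β h * μ h) :=
    Finset.sum_nonneg fun h _ => by split_ifs; exacts [le_rfl, mul_nonneg (hβ h) (hμ0 h)]
  have hgiants0 : 0 ≤ ∑ k ∈ Finset.Ico (j + 1) (M + 1), β k * μ k := Finset.sum_nonneg fun k _ => mul_nonneg (hβ k) (hμ0 k)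
  by_cases hne : Lows.Nonempty
  swap
  · rw [Finset.not_nonempty_iff_eq_empty] at hne
    rw [hLHS, hne, Finset.sum_empty]
    linarith [hRHS]
  obtain ⟨ls, hls, hmax⟩ := Finset.exists_max_image Lows α hne
  have hls' : ls ≤ j ∧ 2 * (ls : ℝ) < T := by
    rw [hLows, Finset.mem_filter, Finset.mem_range] at hls
    exact ⟨by omega, hls.2⟩
  set A := α ls with hA
  by_cases hA0 : A ≤ 0
  · rw [hLHS]
    have : ∑ l ∈ Lows, α l * μ l ≤ 0 :=
      Finset.sum_nonpos fun l hl => mul_nonpos_of_nonpos_of_nonneg ((hmax l hl).trans hA0) (hμ0 l)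
    linarith [hRHS]
  push Not at hA0
  -- every giant is priced at least `A/u`
  have hgiantSum : A / (x / (1 - x)) * G ≤ ∑ k ∈ Finset.Ico (j + 1) (M + 1), β k * μ k := by
    rw [hG, Finset.mul_sum]
    refine Finset.sum_le_sum fun k hk => ?_
    rw [Finset.mem_Ico] at hk
    have h1 := hαβ ls k hls'.1 hls'.2 (by omega) (Or.inl (by omega))
    rw [usage_giant_eq x T j ls k (by omega)] at h1
    have : A / (x / (1 - x)) ≤ β k := by rw [div_le_iff₀ hu0]; linarith
    exact mul_le_mul_of_nonneg_right this (hμ0 k)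
  -- normalise: `α/A ≤ 1`, mid prices `β/A`
  have key := hprice (fun l => α l / A) (fun h => β h / A) (fun h => div_nonneg (hβ h) hA0.le)
    (fun l hl h2 => by
      rw [div_le_one hA0]
      exact hmax l (by rw [hLows, Finset.mem_filter, Finset.mem_range]; exact ⟨by omega, h2⟩))
    (fun l h hl h2 hh hhM hh2 hc => by
      rw [mul_div_assoc']
      exact div_le_div_of_nonneg_right (hαβ l h hl h2 hhM (Or.inr hc)) hA0.le)
  -- undo the normalisation
  have e1 : ∑ l ∈ Finset.range (j + 1), (if 2 * (l : ℝ) < T then α l / A * μ l else 0)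
      = (∑ l ∈ Finset.range (j + 1), (if 2 * (l : ℝ) < T then α l * μ l else 0)) / A := by
    rw [Finset.sum_div]
    refine Finset.sum_congr rfl fun l _ => ?_
    split_ifs <;> ring
  have e2 : ∑ h ∈ Finset.range (j + 1), (if 2 * (h : ℝ) < T then 0 else β h / A * μ h)
      = (∑ h ∈ Finset.range (j + 1), (if 2 * (h : ℝ) < T then 0 else β h * μ h)) / A := by
    rw [Finset.sum_div]
    refine Finset.sum_congr rfl fun h _ => ?_
    split_ifs <;> ring
  rw [e1, e2, div_add' _ _ _ hA0.ne', div_le_div_iff_of_pos_right hA0] at key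
  have e3 : (1 - x) / x * G * A = A / (x / (1 - x)) * G := by
    field_simp
  rw [e3] at key
  linarith [hRHS, hgiantSum]

end LawDec

end Quant

end Summit.CriticalPhenomena.PercolationContinuityZ3.Theorems
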